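import Summits.BirchSwinnertonDyer.Rank1Residual.Additive.QuadraticBranchPlusEtaNodes
import Literature.NumberTheory.EllipticCurves.GreenbergVatsal2000.CongruentCurves
import HarnessLib

/-!
# Route `QuadraticBranchSignedControl` (rung K8, cell `bsd-potss`), residual crux `PlusEtaMainConjectureNonsurj`
# (stmt-BirchSwinnertonDyer-19606) — DEFINITION for the «CM-unit-anchor transfer» road: ONE explicitly labelled OPEN
# hypothesis, the supersingular Greenberg–Vatsal / Emerton–Pollack–Weston transfer of Corpuz–Lei (arXiv:2508.09733,
# August 2025, PREPRINT) AT THE QUADRATIC BRANCH `η = ω^{(p−1)/2}`, in the `η`-currency of the tree (seat `bsd-potss-k8eta-c2` g8)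

HONEST FRAMING: an UNREFEREED preprint enters the tree ONLY as an explicitly labelled OPEN hypothesis
(`@[conjecture] def … : Prop` — an OBLIGATION of ours until the preprint is refereed or re-proved here; nothing
asserted; consumers take it as a binder `(hCL : CorpuzLei2025_etaPlusMainConjecture_transfer_OPEN)`). This is the
`η`-TWIN of the `ω⁰`-binder `Summit.….Theorems.CorpuzLei2025_signedMainConjecture_transfer_OPEN` of the route
`SignedLowerHalves` (cell `bsd-ssimc`, file `Theorems/CorpuzLei2025_signedMainConjecture_transfer_OPEN.lean`: the same
three theorems read at `i = 0`, i.e. over the cyclotomic `ℤ_p`-extension, for Kobayashi's `Sel^±(E/ℚ_∞)`); the print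
states its Theorems 1–3 for EVERY `ω^i`-isotypic component, `0 ≤ i ≤ p − 2`, and K8's crux lives at `i = (p−1)/2`.
Nothing about any curve is asserted; nothing is booked; BSD is not proved by any of this.

## Why (crux 19606, skeleton v5 `Cruxes/PlusEtaMainConjectureNonsurj/Lines/birth.lean`)

On the NON-CM rows of the crux (good supersingular `a_p(V) = 0` twists `V = W ⊗ χ_{p*}`, `p ≥ 5`, whose `p`-adic tower is
not onto: `Im ρ̄_{V,p} = C_ns⁺(p)`, k8eta-c2 g0 `not_forall_surj_pow_iff_cartanNormalizer`) nothing in print gives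
Kobayashi's even main conjecture at `η` (C1⁺_η): Kato's divisibility is only rational there (Thm. 4.1's `pⁿ`), and no
Euler-system lower bound exists off the onto locus (stubs `stub_etaMC_nonCM_upper` / `stub_etaMC_nonCM_lower`). The
cell's census (k8eta-c2 g3–g7; this seat's `work/kit/k8discover.py`, table
`pub/bsd-potss/k8eta-c2/g8/K8-CM-UNIT-ANCHORS-k8eta-c2-g8.tsv`) shows that EVERY one of the 30 non-CM rows of the crux below
`5·10⁵` (all at `p = 5`; 12 of rank 0, 16 of rank 1, 2 of rank 2) is `5`-congruent — by an explicit point of one of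
Fisher's two Hesse families, a theorem of record (`HesseFamilyFive.thm132_…` / `thm58_…`) — to a CM curve `A` of
analytic rank `0` with `5 ∤ #Ш(A)_an · Tam(A)` (a CM UNIT ANCHOR: `900b1`, `3600bb1`, `10800cj1`, `11025e1`, `14400cz1`,
or the unit siblings `[0,0,0,0,−675]`, `[0,0,1,0,−169]`, `[0,0,0,0,800]`, `[0,0,1,0,−405169]` of the classes of `2700p1`,
`675a1`, `14400l1`, `11025b1`), and at the twist `V′` of such an anchor (C1⁺_η) HOLDS WITH `μ = 0` by tree theorems
with no Iwasawa-theoretic input (`EtaUnitRows.etaMC_cm_unitRows`: `X⁺(V′/K_∞)^η = 0` and `L_p⁺(V′,η,X) ∈ Λˣ`, modulo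
modularity, GZK and Burungale–Flach bsd.S28; `EtaMuBound.eta_hasUnitContent_of_selmer_trivial_of_not_dvd_tamagawa`).
Main conjectures transfer along congruences when `μ = 0` (Greenberg–Vatsal 2000 / Emerton–Pollack–Weston 2006,
ordinary); at a non-ordinary prime and on every `ω^i`-component this is Corpuz–Lei's 2025 PREPRINT — the binder
below. Its consumer (`Theorems/QuadraticBranchSignedControlPlusEtaNonsurjCMAnchorTransfer.lean`, this seat) proves
(C1⁺_η)(V,p) for EVERY such row, of ANY rank and ANY shape of `L_p⁺`, modulo the binder + modularity + GZK + bsd.S28 +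
one Fisher fact, with per row ONLY the anchor's `L(A,1) ≠ 0`, `#Ш(A)_an`, `Tam(A)` displayed — no (A), no `L₀`, no
Hatley–Lei, no analytic `μ` at the row, no Kobayashi Thm. 2.2/4.1, no Poitou–Tate, no image hypothesis.

## Source (READ for this file: materialised text `paper:arxiv-2508.09733`, pp. 1–5 and 15–16)

R. Corpuz, A. Lei, *Congruences of `p`-adic `L`-functions of modular forms at non-ordinary primes*, arXiv:2508.09733
(August 2025) [CorpuzLei2025]. Setting (pp. 3–4): "We fix once and for all a prime `p ≥ 3` … a pair of normalized
cuspidal eigenforms `f = ∑ a_n qⁿ ∈ S_k(Γ₁(N_f), ε_f)` and `g = ∑ b_n qⁿ ∈ S_k(Γ₁(N_g), ε_g)` that are non-ordinary at `p`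
with `lcm(N_f,N_g) ≥ 4`. … We write `L_p(∗, ♮, ω^i, X) ∈ 𝒪⟦X⟧ ⊗ E` for the `ω^i`-isotypic component of the signed `p`-adic
`L`-function `L_p(∗,♮)` for `∗ ∈ {f,g}` and `♮ ∈ {♯,♭}`." Assumptions: "1. (analytic congruence) … `a_m ≡ b_m mod ϖ^r` …
2. (Fontaine–Laffaille) `p > k`. 3. (unramified) The extension `E/ℚ_p` is unramified. 4. (non-zero) `♮ ∈ {♯,♭}` and
`i ∈ {0,…,p−2}` are such that both `L_p(f, ♮, ω^i, X)` and `L_p(g, ♮, ω^i, X)` are non-zero. 5. (algebraic congruence)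
`T_f/ϖT_f ≅ T_g/ϖT_g` as `G_ℚ`-representations." (p. 4: "Assumption (5) implies that Assumption (1) holds for `r = 1`.")
**Theorem 1** (= Thm. 5.3, p. 15): "Let `f` and `g` be `p`-non-ordinary modular forms, `i ∈ {0,…,p−2}` and `♮ ∈ {♯,♭}`
satisfying Assumptions 2–5. Let `Σ₀` be the finite set of primes dividing `N_f N_g`. Then `μ(f, ω^i)^♮_an = 0` if and
only if `μ(g, ω^i)^♮_an = 0`, in which case `λ(f, ω^i)^♮_an = λ(g, ω^i)^♮_an + ∑_{v∈Σ₀} (e_v(g, ω^i) − e_v(f, ω^i))`".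
**Theorem 2** (= Thm. 5.9, p. 16, "follows from the results in [HL19]"): the same for `μ(∗, ω^i)^♮_alg`, `λ(∗, ω^i)^♮_alg`
of the signed Selmer duals `𝒳^♮(∗)^{ω^i}`, which are `Λ`-torsion. **Theorem 3** (= Thm. 5.10, p. 16): "Let `f`, `g`, `♮`
and `i` be chosen so that Assumptions 2–5 hold. If `μ(∗, ω^i)^♮_alg = μ(∗, ω^i)^♮_an = 0` for `∗ ∈ {f,g}`, then
Conjecture (IMC) holds for `𝒳^♮(f)^{ω^i}` if and only if it holds for `𝒳^♮(g)^{ω^i}`." Conjecture 5.6 (IMC) (p. 15):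
"`Char_{𝒪⟦G_∞⟧}(𝒳^♮(f)^{ω^i}) = (L_p(f,♮,ω^i,X)/ξ_{i,♮})`", with Remark 5.5: "Kato's main conjecture without `p`-adic zeta
function, as formulated in [kato04] is equivalent to" it; Prop. 5.8 (p. 15): its inclusion "`⊇`" holds RATIONALLY with no
image hypothesis ([LLZ]), and integrally once `μ_alg = μ_an = 0` ("The assumption on the vanishing of the `μ`-invariants
allows us to remove the constant `p^{n_i^♮}`", p. 16 — the constant being "the ratio of the respective periods utilized").

## Transcription (the COMPOSITE «Thm 1 + Thm 2 + Thm 3», weight `2`, rational coefficients, `i = (p−1)/2`, the plus sign)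

For two ELLIPTIC CURVES over `ℚ` — the row's twist `V` (`f = f_V`) and the anchor's twist `V′` (`g = f_{V′}`), globally
minimal models — and an odd prime `p` of GOOD reduction for both with `a_p(V) = a_p(V′) = 0` (non-ordinary; `k = 2 < p`
and `E = ℚ_p`, `ϖ = p` make Assumptions 2–3 automatic; `lcm(N_f,N_g) ≥ 11`; Assumption 4 is Rohrlich's non-vanishing,
built into the tree's node — `IsQuadraticBranchPlusLFunction.ne_zero_of_isNewformOf`, PROVED), and a `Γ_ℚ`-equivariant
additive isomorphism `V′[p] ≃ V[p]` (Assumption 5, hence 1; spelled VERBATIM as the body of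
`Rank1Residual.O6.ModPCongruent V′ V p`, the binder of the cell's records and of
`HatleyLei2019.thm46_etaSignedMu_eq_zero_iff_of_torsionIso`). DICTIONARY (reading flag `CL25-eta-plus-dictionary`):
at `a_p = 0` the sharp/flat objects built from the logarithm matrix / Wach-module Coleman maps of [LLZ, BF] ARE
Kobayashi's `∓` ones (Lei–Loeffler–Zerbes 2010 §5.3, as recorded in the tree's `HatleyLei2019/SignedSelmerEtaCongruentMuInvariant.lean`);
the `ω^{(p−1)/2}`-isotypic component of `𝒳^♮(∗)` over `ℚ(μ_{p^∞})` is Kobayashi's `X^±(E/K_∞)^η` at THE quadratic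
character `η` (the tree's `EtaSignedSelmerDualData ∗ κ K₀ ℚ_[p] ηq γ 1` inside the node
`QuadraticBranchPlusEtaMainConjectureAt`); "Conjecture (IMC) for `𝒳^♮(∗)^{ω^{(p−1)/2}}`" (♮ the sign matching Kobayashi's
`+`) is read as the tree's node `QuadraticBranchPlusEtaMainConjectureAt ∗ p` — Kobayashi's even main conjecture at `η`
VERBATIM (`Char(X⁺(∗/K_∞)^η) = (L_p⁺(∗,η,X))`) — both being "Kato's main conjecture for `T_p∗` at the component `η`"
(Remark 5.5 of the print; Kobayashi 2003 proof of Thm. 7.4, p. 13); the print's `L_p(∗,♮,ω^i,X)/ξ_{i,♮}` uses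
cohomological periods, the node the Néron period of `∗` times the ratio `ϖ` (`ϖ·Ω = Ω⁺_f`) and is ideal-level
(flag `Kob03-Lpm-eta-upto-unit`): for irreducible `∗[p]` and `p ∤ N_∗` the two normalisations differ by a `p`-adic unit
(Greenberg–Vatsal 2000 §3; the print itself removes the residual `p`-power by the `μ = 0` hypothesis, proof of Prop. 5.8).
"`μ_alg(g) = 0`" is read, as in `GreenbergVatsal2000.thm14_mainConjecture_transfer_of_torsionIso` and in the cell's v5
skeleton (`EtaMuZeroAt`), as: every generator of the characteristic ideal of every `η`-dual datum of `V′` has UNIT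
CONTENT (`GreenbergVatsal2000.HasUnitContent`; `muInvariant_eq_zero_iff_hasUnitContent`); given Conjecture (IMC) for `g`
this is also "`μ_an(g) = 0`". So the composite reads: IF `V′[p] ≃ V[p]`, Kobayashi's even main conjecture at `η` holds for
`(V′, p)` AND `μ(X⁺(V′/K_∞)^η) = 0`, THEN Kobayashi's even main conjecture at `η` holds for `(V, p)` (Theorems 1–2 transfer
the two `μ = 0` to `f_V`, Theorem 3 transfers the equality). WEAKER than the print (the conclusion drops `V`'s `μ = 0` and
the `λ`-formulae; only `i = (p−1)/2`, the plus sign, weight `2`), never stronger.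
`-- TODO(general form): every ω^i, both signs, weight k < p, coefficient fields; the λ-transition formulae of Thms 1–2.`

References: [CorpuzLei2025] Thms 1–3 (= 5.3, 5.9, 5.10), Conj. 5.6, Rem. 5.5, Prop. 5.8, Assumptions 1–5 (arXiv:2508.09733
pp. 3–4, 15–16); [Kobayashi2003] §4 Even main conjecture (p. 8), Thm. 7.4 (p. 13); [GreenbergVatsal2000] (1)–(2) and §3;
[HatleyLei2019] Thm. 4.6 (the algebraic side, as cited by the print); [LeiLoefflerZerbes2010] §5.3 (♯/♭ = ∓ at `a_p = 0`).
-/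

set_option autoImplicit false
set_option linter.dupNamespace false

noncomputable section

open scoped Classical

open CongruenceSubgroup WeierstrassCurve Field Literature.NumberTheory.EllipticCurves
  Literature.NumberTheory.EllipticCurves.ModularForms Literature.NumberTheory.GaloisRepresentations
  Literature.NumberTheory.EllipticCurves.GreenbergVatsal2000 ZpExtension
  Summit.BirchSwinnertonDyer.Rank1Residual.Additive

namespace Summit.BirchSwinnertonDyer.BirchSwinnertonDyer.Theorems

/-- **OPEN HYPOTHESIS — UNREFEREED PREPRINT (Corpuz–Lei, arXiv:2508.09733, 2025), Theorems 1 + 2 + 3 composed, at the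
quadratic branch `i = (p−1)/2`, plus sign, for two congruent elliptic curves with `a_p = 0`.** For globally minimal
`V, V′ / ℚ`, an odd prime `p` of good reduction for both with `a_p(V) = a_p(V′) = 0`, and a `Γ_ℚ`-equivariant additive
isomorphism `V′[p] ≃ V[p]` (the body of `Rank1Residual.O6.ModPCongruent V′ V p`): IF Kobayashi's even main conjecture
at `η = ω^{(p−1)/2}` holds for `(V′, p)` (the node `QuadraticBranchPlusEtaMainConjectureAt V′ p`: `X⁺(V′/K_∞)^η`
finitely generated torsion and `Char = (L_p⁺(V′,η,X))` for every `η`-frame and every dual datum) AND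
`μ(X⁺(V′/K_∞)^η) = 0` in Greenberg–Vatsal's reading (every generator of the characteristic ideal of every `η`-dual datum
of `V′` has unit content — the cell's `EtaMuZeroAt V′ p` spelled out), THEN Kobayashi's even main conjecture at `η` holds
for `(V, p)` (`QuadraticBranchPlusEtaMainConjectureAt V p`). (Print: Thm 1 `μ_an` transfers, Thm 2 `μ_alg` transfers,
Thm 3 Conjecture (IMC) for `𝒳^♮(∗)^{ω^i}` transfers when all four `μ` vanish; here `i = (p−1)/2`, `k = 2 < p`, coefficient
field `ℚ_p`, `♯/♭ = ∓` at `a_p = 0`; dictionary and period reading in the module docstring, flag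
`CL25-eta-plus-dictionary`.) NEVER cite this `Prop` as a theorem; take it as an explicit hypothesis
`(hCL : CorpuzLei2025_etaPlusMainConjecture_transfer_OPEN)`. Weaker than the print, never stronger.
[claim: CorpuzLei2025, status: under-review]
[cite: Kobayashi2003, §4 Even main conjecture (p. 8) and Thm. 7.4 (p. 13)]
[cite: GreenbergVatsal2000, p. 2, (1)–(2) and §3 (the ordinary prototype Thm. (1.4))] -/
@[conjecture] def CorpuzLei2025_etaPlusMainConjecture_transfer_OPEN : Prop :=
  ∀ (V V' : WeierstrassCurve ℚ) [V.IsElliptic] [V.IsGloballyMinimal] [V'.IsElliptic] [V'.IsGloballyMinimal]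
    (p : ℕ) [Fact p.Prime],
    p ≠ 2 →
    V.HasGoodReductionAtPrime p → V.frobeniusTrace p = 0 →
    V'.HasGoodReductionAtPrime p → V'.frobeniusTrace p = 0 →
    (∃ e : geomTorsion V' (p : ℤ) ≃+ geomTorsion V (p : ℤ),
      ∀ (σ : absoluteGaloisGroup ℚ) (P : geomTorsion V' (p : ℤ)), e (σ • P) = σ • e P) →
    QuadraticBranchPlusEtaMainConjectureAt V' p →
    (∀ (K₀ : Type) [Field K₀] [NumberField K₀] [IsCyclotomicExtension {p} ℚ K₀]
        [(galRange (K := ℚ) K₀).Normal] (ηq : absoluteGaloisGroup ℚ →* ℤˣ),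
        (∀ σ ∈ galRange (K := ℚ) K₀, ηq σ = 1) → ηq ≠ 1 →
      ∀ (κ : ZpExtension ℚ p) (γ : absoluteGaloisGroup ℚ),
        κ.IsCyclotomic → κ.IsTopGenerator γ → γ ∈ galRange (K := ℚ) K₀ →
      ∀ (D : EtaSignedSelmerDualData V' κ K₀ ℚ_[p] ηq γ 1) (g : IwasawaAlgebra p),
        D.charIdeal = Ideal.span {g} → HasUnitContent g) →
    QuadraticBranchPlusEtaMainConjectureAt V p

end Summit.BirchSwinnertonDyer.BirchSwinnertonDyer.Theorems

end


/-! ## APPEND (seat `bsd-potss-k8eta-c2` g8, same session): the same composite with the anchor's `μ = 0` read on the ANALYTIC side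

WHY. The binder above reads the print's hypothesis "`μ(g, ω^i)^♮_alg = 0`" at the anchor `V′` in Greenberg–Vatsal's ALGEBRAIC form (every
characteristic generator of every `η`-dual datum has unit content, over every frame `(K₀, ηq, κ, γ)`), which the tree certifies at CM UNIT
anchors (`EtaMuBound.eta_hasUnitContent_of_selmer_trivial_of_not_dvd_tamagawa`). CORRECTION OF RECORD (this seat's census
K8-CM-UNIT-ANCHORS-k8eta-c2-g8.tsv): of the nine CM unit anchors of the 30 non-CM rows, the four unit SIBLINGS `[0,0,0,0,−675]`, `[0,0,1,0,−169]`,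
`[0,0,0,0,800]`, `[0,0,1,0,−405169]` have `v₅(c₆) = 2`, so their `5`-twists have ADDITIVE reduction at `5` (`v₅(Δ_min) = 10`) and cannot serve
as the congruent GOOD `a_p = 0` curve the print (and the binder) requires; the 16 rows of their classes (those of `2700p1`, `675a1`, `14400l1`,
`11025b1`) must be anchored instead at the RANK-1 CM anchors of record `2700p1`, `675a1`, `14400l1`, `11025b1` (`v₅(c₆) = 3`, twist good at `5`,
`a_5 = 0`), where Kobayashi's even main conjecture at `η` holds modulo Burungale–Tian + (A) at the anchor + the analytic `μ = 0` at the anchor's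
twist (`EtaFineRoad.etaMC_cmRows_of_bt26_of_conjA_of_analyticMu`, k8eta-c2 g7), and where `μ = 0` is natively ANALYTIC (the displayed
`AnalyticEtaMuZeroAt`, PARI-certified per row, k8eta-c2 g3) — the algebraic `μ = 0` in the frame of the binder above would need a change-of-frame
lemma the tree does not have. Reading the print's anchor hypotheses as "Conjecture (IMC) for `g` AND `μ(g, ω^i)^♮_an = 0`" is equally faithful:
GIVEN Conjecture (IMC) for `g`, `μ_alg(g) = μ_an(g)` (same ideal), and Theorems 1–2 then transfer both vanishings to `f`. Nothing else changes.
-/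

namespace Summit.BirchSwinnertonDyer.BirchSwinnertonDyer.Theorems

open CongruenceSubgroup WeierstrassCurve Field Literature.NumberTheory.EllipticCurves
  Literature.NumberTheory.EllipticCurves.ModularForms Literature.NumberTheory.GaloisRepresentations
  Literature.NumberTheory.EllipticCurves.GreenbergVatsal2000 ZpExtension
  Summit.BirchSwinnertonDyer.Rank1Residual.Additive

/-- **OPEN HYPOTHESIS — UNREFEREED PREPRINT (Corpuz–Lei, arXiv:2508.09733, 2025), Theorems 1 + 2 + 3 composed, at the quadratic branch
`i = (p−1)/2`, plus sign — variant with the anchor's `μ = 0` on the ANALYTIC side.** For globally minimal `V, V′ / ℚ`, an odd prime `p` of good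
reduction for both with `a_p(V) = a_p(V′) = 0`, and a `Γ_ℚ`-equivariant additive isomorphism `V′[p] ≃ V[p]`: IF Kobayashi's even main conjecture
at `η = ω^{(p−1)/2}` holds for `(V′, p)` (`QuadraticBranchPlusEtaMainConjectureAt V′ p`) AND the plus `p`-adic `L`-function at `η` of the newform
of `V′` has UNIT CONTENT for every period-normalised choice (`μ_an(g) = 0`; the cell's `AnalyticEtaMuZeroAt V′ p` spelled out — hence, given the
main conjecture for `g`, `μ_alg(g) = 0` too), THEN Kobayashi's even main conjecture at `η` holds for `(V, p)`. Same print, same dictionary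
(flag `CL25-eta-plus-dictionary`), same caveats as `CorpuzLei2025_etaPlusMainConjecture_transfer_OPEN`; weaker than the print, never stronger.
NEVER cite this `Prop` as a theorem; take it as an explicit hypothesis `(hCL : CorpuzLei2025_etaPlusMainConjecture_transfer_anMu_OPEN)`.
[claim: CorpuzLei2025, status: under-review]
[cite: Kobayashi2003, §4 Even main conjecture (p. 8) and Thm. 7.4 (p. 13)]
[cite: GreenbergVatsal2000, p. 2, (1)–(2) and §3 (the ordinary prototype Thm. (1.4))] -/
@[conjecture] def CorpuzLei2025_etaPlusMainConjecture_transfer_anMu_OPEN : Prop :=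
  ∀ (V V' : WeierstrassCurve ℚ) [V.IsElliptic] [V.IsGloballyMinimal] [V'.IsElliptic] [V'.IsGloballyMinimal]
    (p : ℕ) [Fact p.Prime],
    p ≠ 2 →
    V.HasGoodReductionAtPrime p → V.frobeniusTrace p = 0 →
    V'.HasGoodReductionAtPrime p → V'.frobeniusTrace p = 0 →
    (∃ e : geomTorsion V' (p : ℤ) ≃+ geomTorsion V (p : ℤ),
      ∀ (σ : absoluteGaloisGroup ℚ) (P : geomTorsion V' (p : ℤ)), e (σ • P) = σ • e P) →
    QuadraticBranchPlusEtaMainConjectureAt V' p →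
    (∀ {N : ℕ} [NeZero N] {f' : CuspForm (Gamma0 N) 2}, IsNewformOf V' f' →
      ∀ (ϖ' : ℚ), (if Even (p / 2) then (ϖ' : ℝ) * V'.realPeriodRat = plusPeriod f'
          else (ϖ' : ℝ) * V'.imaginaryPeriodRat = minusPeriod f') →
      ∀ (Lη' : IwasawaAlgebra p), IsQuadraticBranchPlusLFunction f' p ϖ' Lη' → HasUnitContent Lη') →
    QuadraticBranchPlusEtaMainConjectureAt V p

end Summit.BirchSwinnertonDyer.BirchSwinnertonDyer.Theorems
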